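import Literature.AnabelianGeometry.EtaleTheta.BiKummerThm44HypOfGaloisCoveringTempered
import Literature.AnabelianGeometry.EtaleTheta.BiKummerThm44SubNHSatFaithfulSlot
import HarnessLib

/-!
# [EtTh] Thm 4.4 (i)∧(ii)∧(iii)∧roots AT THE FAITHFUL [FrdII] Def 2.2 (ii) SLOT, FIRING AT CONSTRUCTED DATA (abc-iut-w6-d048's
# one-component tempered Frobenioid over `B^temp(Π^tp_X)⁰`) ⟸ [AbsAnab] Lem 1.3.8 only (proof-only)

S. Mochizuki, *The étale theta function …* [MochizukiEtTh2009], Thm 4.4 p.94–95, Def 4.1 (iii)(a) p.87; [MochizukiFrdII2008] Def 2.2 (ii) p.17.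

abc-iut-w6-d047 (gen 3).  The faithful-slot closers (p467189) INSTANTIATED at CONSTRUCTED data: abc-iut-w6-d048's
`OneCompTempered.temperedFrobenioid U hU X R S` (p452830/p454025: `Thm44Hyp` inhabited by the identity, `hBD` and `isFrobenioid` and
T44-L03 PROVED there) with the `(N, H)`-saturation slot INSTANTIATED by «∃ hn ho, `def22Ctx X tf haug A (act A) (hact A) H hn ho` is
`(N, H)`-saturated» for ANY lawful descended action datum `act`/`hact` (by `BiKummerDef22CtxActIndependence`, p469236, the resulting
predicate does not depend on that choice at Frobenius-trivial Galois objects):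
* `OneCompTempered.thm44Hyp_preservesNHSaturatedBsFld_faithfulSlot` — T44-L15b at the model ⟸ `hΔ` ONLY (p467189 at the identity `Thm44Hyp`);
* `OneCompTempered.thm44_oneCompTempered_faithfulSlot` — **Thm 4.4 (i) ∧ (ii) ∧ (iii) ∧ `N`-th roots FIRE at constructed data at the faithful
  slot ⟸ `hΔ` ONLY** (abc-iut-w5-d179's `thm44_mkOfConnectedTemperoid_of_baseInj_treeVocabWeak'` ⟸ {hBD₁, hBD₂, T44-L15b}, all three in hand).
PROOF-ONLY (0 definitions; the slot is an inline term).  `hΔ` = [AbsAnab] Lem 1.3.8 ∀-form for the given `X` (FACT-LIST F-0007 shape); `haug` and the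
lawful action datum `act`/`hact` are PARAMETERS of the slot and are NOT constructed here (HONEST SCOPE: at this model every function on a
connected covering is constant — abc-iut-w6-d048's `OneCompTrivFrd`, trivial Galois action — so deck transformations should pull units back
identically and the TRIVIAL action should be lawful; that verification is left open, hence no non-vacuity claim for `act` is made).
Constructed ≠ endorsed; nothing here bears on [IUTchIII] Cor 3.12.
-/

noncomputable section

namespace Literature.AnabelianGeometry.EtaleTheta

open CategoryTheory Function Literature.AlgebraicGeometry.Frobenioids Literature.AnabelianGeometry.SemiGraphs

namespace OneCompTempered

variable (U : Type) [CommGroup U] (hU : ∀ u : U, (∀ N : ℕ+, ∃ g : U, g ^ (N : ℕ) = u) → u = 1)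
  {K : Type} [Field K] (X : SemiGraphs.TemperedArithmeticGroup.{0} K)
  (R S : ((ConnectedPart (BTemp X.Pi))ᵒᵖ ⥤ CommMonCat.{0}) → Prop) (M : OpenNormalSubgroup X.Pi)
  (haug : IsOpenMap X.aug)
  (act : ∀ A : (temperedFrobenioid U hU X R S).category,
    MulDistribMulAction (Aut (TemperedFrobenioid.AE X (temperedFrobenioid U hU X R S) haug A))
      ↥((temperedFrobenioid U hU X R S).units A))
  (hact : ∀ (A : (temperedFrobenioid U hU X R S).category) (α : Aut A) (u : ↥((temperedFrobenioid U hU X R S).units A)),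
    (TemperedFrobenioid.resE X (temperedFrobenioid U hU X R S) haug A α) • u =
      (⟨α * u.1 * α⁻¹, ((temperedFrobenioid U hU X R S).units_normal A).conj_mem _ u.2 α⟩ :
        ↥((temperedFrobenioid U hU X R S).units A)))

/-- **T44-L15b at CONSTRUCTED data at the faithful slot ⟸ `hΔ` only** (p467189's `preservesNHSaturatedBsFld_faithfulSlot` at abc-iut-w6-d048's
identity `Thm44Hyp`). [cite: MochizukiEtTh2009, Thm 4.4 (iii) p.95] -/
theorem thm44Hyp_preservesNHSaturatedBsFld_faithfulSlot
    (hΔ : ∀ θ : X.Pi ≃ₜ* X.Pi, X.delta.map θ.toMulEquiv.toMonoidHom = X.delta) :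
    (thm44Hyp U hU X R S (fun H A N => ∃ (hn : H.Normal) (ho : IsOpen (H : Set (Field.absoluteGaloisGroup K))),
        PadicKummer.IsNHSaturated
          (TemperedFrobenioid.def22Ctx X (temperedFrobenioid U hU X R S) haug A (act A) (hact A) H hn ho) N) M).PreservesNHSaturatedBsFld :=
  (thm44Hyp U hU X R S (fun H A N => ∃ (hn : H.Normal) (ho : IsOpen (H : Set (Field.absoluteGaloisGroup K))),
        PadicKummer.IsNHSaturated
          (TemperedFrobenioid.def22Ctx X (temperedFrobenioid U hU X R S) haug A (act A) (hact A) H hn ho) N) M).preservesNHSaturatedBsFld_faithfulSlot hΔ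

/-- **[EtTh] Thm 4.4 (i) ∧ (ii) ∧ (iii) ∧ `N`-th roots FIRE AT CONSTRUCTED DATA AT THE FAITHFUL SLOT ⟸ `hΔ` ONLY** — abc-iut-w5-d179's
`thm44_mkOfConnectedTemperoid_of_baseInj_treeVocabWeak'` (⟸ {hBD₁, hBD₂, T44-L15b}) with `hBD` = abc-iut-w6-d048's theorem and T44-L15b =
`thm44Hyp_preservesNHSaturatedBsFld_faithfulSlot`. [cite: MochizukiEtTh2009, Thm 4.4 p.94] -/
theorem thm44_oneCompTempered_faithfulSlot
    (hΔ : ∀ θ : X.Pi ≃ₜ* X.Pi, X.delta.map θ.toMulEquiv.toMonoidHom = X.delta) :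
    BiKummerSetting.Thm44_i (thm44Hyp U hU X R S (fun H A N => ∃ (hn : H.Normal) (ho : IsOpen (H : Set (Field.absoluteGaloisGroup K))),
        PadicKummer.IsNHSaturated
          (TemperedFrobenioid.def22Ctx X (temperedFrobenioid U hU X R S) haug A (act A) (hact A) H hn ho) N) M) ∧
      BiKummerSetting.Thm44_ii (thm44Hyp U hU X R S (fun H A N => ∃ (hn : H.Normal) (ho : IsOpen (H : Set (Field.absoluteGaloisGroup K))),
        PadicKummer.IsNHSaturated
          (TemperedFrobenioid.def22Ctx X (temperedFrobenioid U hU X R S) haug A (act A) (hact A) H hn ho) N) M)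
        (ψ U hU X R S (fun H A N => ∃ (hn : H.Normal) (ho : IsOpen (H : Set (Field.absoluteGaloisGroup K))),
        PadicKummer.IsNHSaturated
          (TemperedFrobenioid.def22Ctx X (temperedFrobenioid U hU X R S) haug A (act A) (hact A) H hn ho) N) M) ∧
      BiKummerSetting.Thm44_iii (thm44Hyp U hU X R S (fun H A N => ∃ (hn : H.Normal) (ho : IsOpen (H : Set (Field.absoluteGaloisGroup K))),
        PadicKummer.IsNHSaturated
          (TemperedFrobenioid.def22Ctx X (temperedFrobenioid U hU X R S) haug A (act A) (hact A) H hn ho) N) M)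
        (ψ U hU X R S (fun H A N => ∃ (hn : H.Normal) (ho : IsOpen (H : Set (Field.absoluteGaloisGroup K))),
        PadicKummer.IsNHSaturated
          (TemperedFrobenioid.def22Ctx X (temperedFrobenioid U hU X R S) haug A (act A) (hact A) H hn ho) N) M) ∧
      (thm44Hyp U hU X R S (fun H A N => ∃ (hn : H.Normal) (ho : IsOpen (H : Set (Field.absoluteGaloisGroup K))),
        PadicKummer.IsNHSaturated
          (TemperedFrobenioid.def22Ctx X (temperedFrobenioid U hU X R S) haug A (act A) (hact A) H hn ho) N) M).PreservesNthRoots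
        (ψ U hU X R S (fun H A N => ∃ (hn : H.Normal) (ho : IsOpen (H : Set (Field.absoluteGaloisGroup K))),
        PadicKummer.IsNHSaturated
          (TemperedFrobenioid.def22Ctx X (temperedFrobenioid U hU X R S) haug A (act A) (hact A) H hn ho) N) M)
        (fun φ f => (temperedFrobenioid U hU X R S).pullFracModel φ f)
        fun φ f => (temperedFrobenioid U hU X R S).pullFracModel φ f :=
  (thm44Hyp U hU X R S (fun H A N => ∃ (hn : H.Normal) (ho : IsOpen (H : Set (Field.absoluteGaloisGroup K))),
        PadicKummer.IsNHSaturated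
          (TemperedFrobenioid.def22Ctx X (temperedFrobenioid U hU X R S) haug A (act A) (hact A) H hn ho) N) M).thm44_mkOfConnectedTemperoid_of_baseInj_treeVocabWeak'
    _ _ _ _ _ _ _ _ _ _ _ _ _ _ (fun α => hBD U hU X R S α) (fun α => hBD U hU X R S α)
    (thm44Hyp_preservesNHSaturatedBsFld_faithfulSlot U hU X R S M haug act hact hΔ)

end OneCompTempered

end Literature.AnabelianGeometry.EtaleTheta

end
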